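import Summits.KontsevichZagierPeriods.KontsevichZagierPeriods.Theorems.RootDecompRelativeModAbsoluteCylLogSplitP46

/-! # `RootDecompRelativeModAbsoluteCylLogSplitP47` — part 22/27 of the mechanical ≤400-line split of `RungClosure.lean` (sha256 f909f334226f0fb5…)
Source: decomp-kz lens-3 g12 `RungClosure.lean` v9 (HOME/decomp-kz-lens-3/g12/, sha256 f909f334…; critic g4-52/g4-57/g5 CLEARED, «lander: split v9 --supports 30572»): BLOCK I (57 g11 monolith decls missing from P01–P25), BLOCK II/III (WildCertAssembly parts 1–6, 8–10: `Leaf.cellLocalWildCert`, `Leaf.cylKernelZeroLog_of_trees`), Parts 12–13 (`Leaf.regKernelPairDegOne_iff_circlePos_of_trees`), BLOCK G13 (Möbius engine, test §C decided).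
Split by census-1 g9 `gen/splitlean.py`: scopes re-opened with their `open`/`variable`/`set_option` context; mathematics and declaration order unchanged. -/

noncomputable section
open Set MeasureTheory Filter Topology
open scoped BigOperators
open Literature.NumberTheory.Transcendental Literature.ModelTheory.ExponentialFields
namespace Summit.KontsevichZagierPeriods.RootDecompRelativeModAbsolute.Rung30571.RegularisedLogLayer.CylLog.Leaf

/-- `Fin 3` has three elements. [bookkeeping] -/
private theorem fin3_cases' (t : Fin 3) : t = 0 ∨ t = 1 ∨ t = 2 := by
  fin_cases t <;> simp

/-- The pure positive circle kind is a SPECIAL CASE of the arctangent kind. -/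
theorem cylKernelZeroCirclePos_of_mixed (hM : CylKernelZeroMixed) : CylKernelZeroCirclePos :=
  fun P V a₀ q c κ M e _ hP ha₀ ha₀i hc hκ he h2 hκ1 _ hint hL1 hdom hV hae =>
    hM P V a₀ q c κ M e hP ha₀ ha₀i hc hκ he h2 hκ1 hint hL1 hdom hV hae

/-- **Signed cells: `CylKernelZeroLog ∧ CylKernelZeroCirclePos ⟹ CylKernelZeroMixedSigned` (PROVED).**  If some
arctangent term is positive on the cell, convert the non-positive ones to log kind (Part 12 partial fractions, family
reindexed over `Fin (q + q)`) and apply the pure positive circle kind; otherwise the cell is `CylKernelZeroMixedNonpos`. -/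
theorem cylKernelZeroMixedSigned_of_log_and_circle (hL : CylKernelZeroLog) (hC : CylKernelZeroCirclePos) :
    CylKernelZeroMixedSigned := by
  intro P V a₀ q c κ M e hPo hP ha₀ ha₀i hc hκ he h2 hκ1 hsgn hint hL1 hdom hV hae
  by_cases hpos : ∃ i, e i = 2 ∧ ∀ x ∈ P, 0 < κ i x
  swap
  · -- every arctangent-kind term is non-positive on the cell: Part 12
    refine cylKernelZeroMixedNonpos_of_log hL P V a₀ q c κ M e hP ha₀ ha₀i hc hκ he h2 hκ1 ?_ hint hL1 hdom hV hae
    intro i hi x hx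
    rcases hsgn i hi with hp | hn
    · exact absurd ⟨i, hi, hp⟩ hpos
    · exact hn x hx
  obtain ⟨i₀, hi₀, hpos₀⟩ := hpos
  have hPm : MeasurableSet P := hP.measurableSet_holds
  -- the Bool pattern of the arctangent terms to be converted (non-positive ones)
  have hnp0 : ∀ i, ∃ bb : Bool, (bb = true ↔ (e i = 2 ∧ ¬ ∀ x ∈ P, 0 < κ i x)) := fun i => by
    by_cases h : (e i = 2 ∧ ¬ ∀ x ∈ P, 0 < κ i x)
    · exact ⟨true, iff_of_true rfl h⟩
    · exact ⟨false, iff_of_false Bool.false_ne_true h⟩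
  choose np hnp using hnp0
  have hT : ∀ i, np i = true → e i = 2 ∧ ∀ x ∈ P, κ i x ≤ 0 := fun i h => by
    obtain ⟨hi, hn⟩ := (hnp i).mp h
    rcases hsgn i hi with hp | hle
    · exact absurd hp hn
    · exact ⟨hi, hle⟩
  have hF : ∀ i, np i = false → e i = 2 → ∀ x ∈ P, 0 < κ i x := fun i h hi => by
    by_contra hcon
    have h' := (hnp i).mpr ⟨hi, hcon⟩
    rw [h] at h'
    exact Bool.false_ne_true h'
  have hnp₀ : np i₀ = false := by
    cases h : np i₀
    · rfl
    · exact absurd hpos₀ ((hnp i₀).mp h).2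
  -- `λᵢ = √(−κᵢ)`
  set lam : Fin q → (Fin 1 → ℝ) → ℝ := fun i x => Real.sqrt (-κ i x) with hlamdef
  have hlam0 : ∀ i x, 0 ≤ lam i x := fun i x => Real.sqrt_nonneg _
  have hlam1 : ∀ i, ∀ x ∈ P, lam i x < 1 := by
    intro i x hx
    show Real.sqrt (-κ i x) < 1
    rw [Real.sqrt_lt' one_pos]
    linarith [hκ1 i x hx]
  have hlamsq : ∀ i, np i = true → ∀ x ∈ P, lam i x ^ 2 = -κ i x := fun i hi x hx =>
    Real.sq_sqrt (by linarith [(hT i hi).2 x hx])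
  have hκeq : ∀ i, np i = true → ∀ x ∈ P, κ i x = -(lam i x) ^ 2 := fun i hi x hx => by
    have := hlamsq i hi x hx; linarith
  have hlam_sa : ∀ i, IsSemialgebraicFunOn ℚ P (lam i) := by
    intro i
    have hneg : IsSemialgebraicFunOn ℚ P (fun x => -κ i x) :=
      (IsSemialgebraicFunOn.sub_holds (isSemialgebraicFunOn_ratCast hP 0) (hκ i)).congr fun _ _ => by simp
    exact IsSemialgebraicFunOn.sqrt_holds hneg
  have hnlam_sa : ∀ i, IsSemialgebraicFunOn ℚ P (fun x => -lam i x) := fun i =>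
    (IsSemialgebraicFunOn.sub_holds (isSemialgebraicFunOn_ratCast hP 0) (hlam_sa i)).congr fun _ _ => by simp
  have hhalf_sa : ∀ i, IsSemialgebraicFunOn ℚ P (fun x => (1/2 : ℝ) * c i x) := fun i =>
    (IsSemialgebraicFunOn.mul_holds (isSemialgebraicFunOn_ratCast hP (1/2 : ℚ)) (hc i)).congr
      fun _ _ => by simp only [Pi.mul_apply]; push_cast; ring
  have hzero_sa : IsSemialgebraicFunOn ℚ P (fun _ : Fin 1 → ℝ => (0:ℝ)) :=
    (isSemialgebraicFunOn_ratCast hP 0).congr fun _ _ => by simp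
  -- the box
  set B : Set (Fin (1 + 1) → ℝ) := {z : Fin (1 + 1) → ℝ | (Fin.init z : Fin 1 → ℝ) ∈ P ∧ z (Fin.last 1) ∈ Set.Ioo 0 1}
    with hBdef
  have hBsa : IsSemialgebraic ℚ B := RTerm.isSemialgebraic_cyl hP
  have hBm : MeasurableSet B := hBsa.measurableSet_holds
  have hBP : B ⊆ {z | (Fin.init z : Fin 1 → ℝ) ∈ P} := fun z hz => hz.1
  have hden : ∀ i, ∀ x ∈ P, ∀ θ ∈ Ioo (0:ℝ) 1, 1 - θ * lam i x ≠ 0 ∧ 1 + θ * lam i x ≠ 0 := by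
    intro i x hx θ hθ
    have h0 := hlam0 i x; have h1 := hlam1 i x hx
    have : θ * lam i x < 1 := by nlinarith [hθ.1, hθ.2]
    constructor <;> [exact (show (0:ℝ) < 1 - θ * lam i x by linarith).ne';
      exact (show (0:ℝ) < 1 + θ * lam i x by nlinarith [hθ.1]).ne']
  -- the new data over `Fin (q + q)`
  let c' : Fin (q + q) → (Fin 1 → ℝ) → ℝ :=
    Fin.append (fun i => bif np i then (fun x => (1/2 : ℝ) * c i x) else c i)
      (fun i => bif np i then (fun x => (1/2 : ℝ) * c i x) else fun _ => 0)
  let κ' : Fin (q + q) → (Fin 1 → ℝ) → ℝ :=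
    Fin.append (fun i => bif np i then (fun x => -lam i x) else κ i)
      (fun i => bif np i then lam i else fun _ => 0)
  let M' : Fin (q + q) → ℕ := Fin.append M M
  let e' : Fin (q + q) → ℕ := Fin.append (fun i => bif np i then 1 else e i) (fun _ => 1)
  refine hC P V a₀ (q + q) c' κ' M' e' hPo hP ha₀ ha₀i ?_ ?_ ?_ ?_ ?_ ?_ ?_ ?_ hdom ?_ ?_
  · -- `c'` semialgebraic
    intro j
    refine Fin.addCases (fun i => ?_) (fun i => ?_) j
    · simp only [c', Fin.append_left]
      cases h : np i
      · simp only [cond_false]; exact hc i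
      · simp only [cond_true]; exact hhalf_sa i
    · simp only [c', Fin.append_right]
      cases h : np i
      · simp only [cond_false]; exact hzero_sa
      · simp only [cond_true]; exact hhalf_sa i
  · -- `κ'` semialgebraic
    intro j
    refine Fin.addCases (fun i => ?_) (fun i => ?_) j
    · simp only [κ', Fin.append_left]
      cases h : np i
      · simp only [cond_false]; exact hκ i
      · simp only [cond_true]; exact hnlam_sa i
    · simp only [κ', Fin.append_right]
      cases h : np i
      · simp only [cond_false]; exact hzero_sa
      · simp only [cond_true]; exact hlam_sa i
  · -- `e' ∈ {1, 2}`
    intro j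
    refine Fin.addCases (fun i => ?_) (fun i => ?_) j
    · simp only [e', Fin.append_left]
      cases h : np i
      · simp only [cond_false]; exact he i
      · simp only [cond_true]; exact Or.inl (by trivial)
    · simp only [e', Fin.append_right]; exact Or.inl (by trivial)
  · -- a circle term survives
    exact ⟨Fin.castAdd q i₀, by simp only [e', Fin.append_left, hnp₀, cond_false]; exact hi₀⟩
  · -- `κ' > -1`
    intro j
    refine Fin.addCases (fun i => ?_) (fun i => ?_) j
    · simp only [κ', Fin.append_left]
      cases h : np i
      · simp only [cond_false]; exact hκ1 i
      · simp only [cond_true]; intro x hx; linarith [hlam1 i x hx]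
    · simp only [κ', Fin.append_right]
      cases h : np i
      · simp only [cond_false]; intro x _; norm_num
      · simp only [cond_true]; intro x hx; linarith [hlam0 i x]
  · -- every circle term of the new family is positive
    intro j
    refine Fin.addCases (fun i => ?_) (fun i => ?_) j
    · simp only [e', κ', Fin.append_left]
      cases h : np i
      · simp only [cond_false]; exact hF i h
      · simp only [cond_true]; intro h12; exact absurd h12 (by norm_num)
    · simp only [e', κ', Fin.append_right]; intro h12; exact absurd h12 (by norm_num)
  · -- termwise integrability on the box
    intro j
    refine Fin.addCases (fun i => ?_) (fun i => ?_) j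
    · simp only [c', κ', M', e', Fin.append_left]
      cases h : np i
      · simp only [cond_false]; exact hint i
      · simp only [cond_true, pow_one]
        have hsa := sa_cylTerm (M i) hBsa hBP (hhalf_sa i) (hnlam_sa i) (fun z hz => by
          have := (hden i _ hz.1 _ hz.2).1
          intro h0; apply this; linarith)
        refine Integrable.mono' (hint i).norm (KZ.aestronglyMeasurable_of_isSemialgebraicFunOn hsa hBm) ?_
        filter_upwards [ae_restrict_mem hBm] with z hz
        obtain ⟨k1n, -, k3n, hk1, -⟩ := kernel_bounds (M i) hz.2.1 hz.2.2 (hlam0 i _) (hlam1 i _ hz.1)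
        have e3 : (1:ℝ) + z (Fin.last 1) ^ 2 * -(lam i (Fin.init z)) ^ 2 =
            1 - z (Fin.last 1) ^ 2 * lam i (Fin.init z) ^ 2 := by ring
        rw [(hT i h).1, hκeq i h _ hz.1, e3, Real.norm_eq_abs, Real.norm_eq_abs, abs_mul, abs_mul, abs_mul,
          abs_of_nonneg k1n, abs_of_nonneg k3n, abs_of_nonneg (by norm_num : (0:ℝ) ≤ 1/2)]
        nlinarith [mul_le_mul_of_nonneg_left hk1 (abs_nonneg (c i (Fin.init z)))]
    · simp only [c', κ', M', e', Fin.append_right]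
      cases h : np i
      · simp only [cond_false, zero_mul]
        exact integrableOn_zero
      · simp only [cond_true, pow_one]
        have hsa := sa_cylTerm (M i) hBsa hBP (hhalf_sa i) (hlam_sa i) (fun z hz => (hden i _ hz.1 _ hz.2).2)
        refine Integrable.mono' (hint i).norm (KZ.aestronglyMeasurable_of_isSemialgebraicFunOn hsa hBm) ?_
        filter_upwards [ae_restrict_mem hBm] with z hz
        obtain ⟨-, k2n, k3n, -, hk2⟩ := kernel_bounds (M i) hz.2.1 hz.2.2 (hlam0 i _) (hlam1 i _ hz.1)
        have e3 : (1:ℝ) + z (Fin.last 1) ^ 2 * -(lam i (Fin.init z)) ^ 2 =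
            1 - z (Fin.last 1) ^ 2 * lam i (Fin.init z) ^ 2 := by ring
        rw [(hT i h).1, hκeq i h _ hz.1, e3, Real.norm_eq_abs, Real.norm_eq_abs, abs_mul, abs_mul, abs_mul,
          abs_of_nonneg k2n, abs_of_nonneg k3n, abs_of_nonneg (by norm_num : (0:ℝ) ≤ 1/2)]
        nlinarith [mul_le_mul_of_nonneg_left hk2 (abs_nonneg (c i (Fin.init z)))]
  · -- integrability of the fibre functions on the base
    intro j
    refine Fin.addCases (fun i => ?_) (fun i => ?_) j
    · simp only [c', κ', M', e', Fin.append_left]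
      cases h : np i
      · simp only [cond_false]; exact hL1 i
      · simp only [cond_true, pow_one]
        have hmeas : AEStronglyMeasurable
            (fun x => (1/2 : ℝ) * c i x * ∫ θ in Ioo (0:ℝ) 1, θ ^ M i / (1 + θ * -lam i x)) (volume.restrict P) :=
          (KZ.aestronglyMeasurable_of_isSemialgebraicFunOn (hhalf_sa i) hPm).mul
            (aestronglyMeasurable_fibreLog
              (KZ.aestronglyMeasurable_of_isSemialgebraicFunOn (hnlam_sa i) hPm).aemeasurable (M i))
        refine Integrable.mono' (hL1 i).norm hmeas ?_
        filter_upwards [ae_restrict_mem hPm] with x hx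
        have hl0 := hlam0 i x; have hl1 := hlam1 i x hx
        have hI1 : IntegrableOn (fun θ : ℝ => θ ^ M i / (1 + θ * -lam i x)) (Ioo (0:ℝ) 1) :=
          integrableOn_kernel_lin (M i) (by linarith)
        have hI3 : IntegrableOn (fun θ : ℝ => θ ^ M i / (1 - θ ^ 2 * lam i x ^ 2)) (Ioo (0:ℝ) 1) :=
          integrableOn_kernel_sq (M i) hl0 hl1
        have hJ1n : 0 ≤ ∫ θ in Ioo (0:ℝ) 1, θ ^ M i / (1 + θ * -lam i x) :=
          setIntegral_nonneg measurableSet_Ioo fun θ hθ => (kernel_bounds (M i) hθ.1 hθ.2 hl0 hl1).1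
        have hJ3n : 0 ≤ ∫ θ in Ioo (0:ℝ) 1, θ ^ M i / (1 - θ ^ 2 * lam i x ^ 2) :=
          setIntegral_nonneg measurableSet_Ioo fun θ hθ => (kernel_bounds (M i) hθ.1 hθ.2 hl0 hl1).2.2.1
        have hle : (1/2 : ℝ) * (∫ θ in Ioo (0:ℝ) 1, θ ^ M i / (1 + θ * -lam i x)) ≤
            ∫ θ in Ioo (0:ℝ) 1, θ ^ M i / (1 - θ ^ 2 * lam i x ^ 2) := by
          rw [← integral_const_mul]
          exact setIntegral_mono_on (hI1.const_mul _) hI3 measurableSet_Ioo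
            fun θ hθ => (kernel_bounds (M i) hθ.1 hθ.2 hl0 hl1).2.2.2.1
        have e4 : (fun θ : ℝ => θ ^ M i / (1 + θ ^ 2 * -(lam i x) ^ 2)) =
            fun θ => θ ^ M i / (1 - θ ^ 2 * lam i x ^ 2) := by
          funext θ; ring
        rw [(hT i h).1, hκeq i h x hx, e4, Real.norm_eq_abs, Real.norm_eq_abs, abs_mul, abs_mul, abs_mul,
          abs_of_nonneg hJ1n, abs_of_nonneg hJ3n, abs_of_nonneg (by norm_num : (0:ℝ) ≤ 1/2)]
        nlinarith [mul_le_mul_of_nonneg_left hle (abs_nonneg (c i x))]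
    · simp only [c', κ', M', e', Fin.append_right]
      cases h : np i
      · simp only [cond_false, zero_mul]
        exact integrableOn_zero
      · simp only [cond_true, pow_one]
        have hmeas : AEStronglyMeasurable
            (fun x => (1/2 : ℝ) * c i x * ∫ θ in Ioo (0:ℝ) 1, θ ^ M i / (1 + θ * lam i x)) (volume.restrict P) :=
          (KZ.aestronglyMeasurable_of_isSemialgebraicFunOn (hhalf_sa i) hPm).mul
            (aestronglyMeasurable_fibreLog
              (KZ.aestronglyMeasurable_of_isSemialgebraicFunOn (hlam_sa i) hPm).aemeasurable (M i))
        refine Integrable.mono' (hL1 i).norm hmeas ?_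
        filter_upwards [ae_restrict_mem hPm] with x hx
        have hl0 := hlam0 i x; have hl1 := hlam1 i x hx
        have hI2 : IntegrableOn (fun θ : ℝ => θ ^ M i / (1 + θ * lam i x)) (Ioo (0:ℝ) 1) :=
          integrableOn_kernel_lin (M i) (by linarith)
        have hI3 : IntegrableOn (fun θ : ℝ => θ ^ M i / (1 - θ ^ 2 * lam i x ^ 2)) (Ioo (0:ℝ) 1) :=
          integrableOn_kernel_sq (M i) hl0 hl1
        have hJ2n : 0 ≤ ∫ θ in Ioo (0:ℝ) 1, θ ^ M i / (1 + θ * lam i x) :=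
          setIntegral_nonneg measurableSet_Ioo fun θ hθ => (kernel_bounds (M i) hθ.1 hθ.2 hl0 hl1).2.1
        have hJ3n : 0 ≤ ∫ θ in Ioo (0:ℝ) 1, θ ^ M i / (1 - θ ^ 2 * lam i x ^ 2) :=
          setIntegral_nonneg measurableSet_Ioo fun θ hθ => (kernel_bounds (M i) hθ.1 hθ.2 hl0 hl1).2.2.1
        have hle : (1/2 : ℝ) * (∫ θ in Ioo (0:ℝ) 1, θ ^ M i / (1 + θ * lam i x)) ≤
            ∫ θ in Ioo (0:ℝ) 1, θ ^ M i / (1 - θ ^ 2 * lam i x ^ 2) := by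
          rw [← integral_const_mul]
          exact setIntegral_mono_on (hI2.const_mul _) hI3 measurableSet_Ioo
            fun θ hθ => (kernel_bounds (M i) hθ.1 hθ.2 hl0 hl1).2.2.2.2
        have e4 : (fun θ : ℝ => θ ^ M i / (1 + θ ^ 2 * -(lam i x) ^ 2)) =
            fun θ => θ ^ M i / (1 - θ ^ 2 * lam i x ^ 2) := by
          funext θ; ring
        rw [(hT i h).1, hκeq i h x hx, e4, Real.norm_eq_abs, Real.norm_eq_abs, abs_mul, abs_mul, abs_mul,
          abs_of_nonneg hJ2n, abs_of_nonneg hJ3n, abs_of_nonneg (by norm_num : (0:ℝ) ≤ 1/2)]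
        nlinarith [mul_le_mul_of_nonneg_left hle (abs_nonneg (c i x))]
  · -- the integrand of `V`
    intro z hz
    have hzB : (Fin.init z : Fin 1 → ℝ) ∈ P ∧ z (Fin.last 1) ∈ Ioo (0:ℝ) 1 := by rw [hdom] at hz; exact hz
    have key : (∑ j : Fin (q + q), c' j (Fin.init z) *
          (z (Fin.last 1) ^ M' j / (1 + z (Fin.last 1) ^ e' j * κ' j (Fin.init z)))) =
        ∑ i, c i (Fin.init z) * (z (Fin.last 1) ^ M i / (1 + z (Fin.last 1) ^ e i * κ i (Fin.init z))) := by
      rw [Fin.sum_univ_add]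
      simp only [c', κ', M', e', Fin.append_left, Fin.append_right]
      rw [← Finset.sum_add_distrib]
      refine Finset.sum_congr rfl fun i _ => ?_
      cases h : np i
      · simp only [cond_false, pow_one, zero_mul, mul_zero, add_zero]
      · simp only [cond_true, pow_one]
        obtain ⟨h1ne, h2ne⟩ := hden i _ hzB.1 _ hzB.2
        have hk := half_kernel_add (M i) (θ := z (Fin.last 1)) (l := lam i (Fin.init z)) h1ne h2ne
        have e3 : (1:ℝ) + z (Fin.last 1) ^ 2 * -(lam i (Fin.init z)) ^ 2 =
            1 - z (Fin.last 1) ^ 2 * lam i (Fin.init z) ^ 2 := by ring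
        rw [(hT i h).1, hκeq i h _ hzB.1, e3, ← hk]
        ring
    show V.integrand z = a₀ (Fin.init z) + ∑ j : Fin (q + q), c' j (Fin.init z) *
      (z (Fin.last 1) ^ M' j / (1 + z (Fin.last 1) ^ e' j * κ' j (Fin.init z)))
    rw [key]
    exact hV hz
  · -- the a.e. vanishing of the fibre integrals
    filter_upwards [hae] with x hx hxP
    have key : (∑ j : Fin (q + q), c' j x * ∫ θ in Ioo (0:ℝ) 1, θ ^ M' j / (1 + θ ^ e' j * κ' j x)) =
        ∑ i, c i x * ∫ θ in Ioo (0:ℝ) 1, θ ^ M i / (1 + θ ^ e i * κ i x) := by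
      rw [Fin.sum_univ_add]
      simp only [c', κ', M', e', Fin.append_left, Fin.append_right]
      rw [← Finset.sum_add_distrib]
      refine Finset.sum_congr rfl fun i _ => ?_
      cases h : np i
      · simp only [cond_false, pow_one, zero_mul, mul_zero, add_zero]
      · simp only [cond_true, pow_one]
        have hl0 := hlam0 i x; have hl1 := hlam1 i x hxP
        have hI1 : IntegrableOn (fun θ : ℝ => θ ^ M i / (1 + θ * -lam i x)) (Ioo (0:ℝ) 1) :=
          integrableOn_kernel_lin (M i) (by linarith)
        have hI2 : IntegrableOn (fun θ : ℝ => θ ^ M i / (1 + θ * lam i x)) (Ioo (0:ℝ) 1) :=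
          integrableOn_kernel_lin (M i) (by linarith)
        have e4 : (fun θ : ℝ => θ ^ M i / (1 + θ ^ 2 * -(lam i x) ^ 2)) =
            fun θ => θ ^ M i / (1 - θ ^ 2 * lam i x ^ 2) := by
          funext θ; ring
        rw [(hT i h).1, hκeq i h x hxP, e4]
        have hsum : (∫ θ in Ioo (0:ℝ) 1, θ ^ M i / (1 - θ ^ 2 * lam i x ^ 2)) =
            ∫ θ in Ioo (0:ℝ) 1, ((1/2 : ℝ) * (θ ^ M i / (1 + θ * -lam i x)) +
              (1/2 : ℝ) * (θ ^ M i / (1 + θ * lam i x))) := by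
          refine setIntegral_congr_fun measurableSet_Ioo fun θ hθ => ?_
          obtain ⟨h1ne, h2ne⟩ := hden i x hxP θ hθ
          exact (half_kernel_add (M i) h1ne h2ne).symm
        rw [hsum, integral_add (hI1.const_mul _) (hI2.const_mul _), integral_const_mul, integral_const_mul]
        ring
    rw [key]
    exact hx hxP

end Summit.KontsevichZagierPeriods.RootDecompRelativeModAbsolute.Rung30571.RegularisedLogLayer.CylLog.Leaf
end
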